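import Literature.Probability.Percolation.SlabCircuitSideCrossings
import Literature.Probability.Percolation.SlabRSWLemma311
import Literature.Probability.Percolation.SlabRSWProp39Iter
import Literature.Probability.Percolation.SlabRSWGluingOrient
import HarnessLib

/-!
# Newman–Tassion–Wu 2017, Theorem 3.10 — a long-way crossing of a hub strip crosses many disjoint
# hard boxes: `P[hub strip crossed] ≤ f_p(2n, n-1)^m`

Topic: `Literature/Probability/Percolation`. Ninth file of the port of THEOREM 3.10 of
Newman–Tassion–Wu, *Critical percolation and the minimal spanning tree in slabs* (CPAM 70 (2017);
arXiv:1512.09107, p. 13): "an open path from `L(S₂)` to `T(S₂)` inside `S₂` must cross `λ` (actually,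
`2λ`) disjoint `2n` by `n - 1` rectangles in the long direction, and each of these crossings occur
with probability less than `1/2` by Equation (3.34).  Therefore … `P[L(S₂) ⟷^{S₂} T(S₂)] ≤ 2^{-λ}`."
For the port's hub strips (`SlabCircuitFromCornerLinks.lean`, `n` lattice lines across, crossed the
long way: `hubCross*` of `SlabCircuitSideCrossings.lean`):

* `slabConn_block_of_hcross` — a long-way crossing of a strip contains, for every translate of the
  hard box `boxR 0 (2n) 0 (n-1)` placed ACROSS the strip strictly between the crossing's ends, a
  crossing of that box in its long direction (`exists_crossVertex`).
* `real_hblock_eq_crossingProb`, `real_vblock_eq_crossingProb` — by translation and the diagonal symmetry every such block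
  crossing has probability `crossingProb k p (2n) (n-1) = f_p(2n, n-1)`.
* **`real_hcross_le_pow` / `real_vcross_le_pow`** — for a horizontal (resp. vertical) strip of `n`
  lines crossed between end lines at distance `> m(2n+1)`: `P ≤ f_p(2n,n-1)^m` (independence of the
  `m` disjoint blocks, the tree's `real_biInter_eq_prod`).
* **`real_hubCross_le_pow`** — the four hub strips: `P[hubCross_X] ≤ f_p(2n,n-1)^m` whenever
  `m(2n+1) ≤ 2N-3`.

## Sources

* C. M. Newman, V. Tassion, W. Wu, *Critical percolation and the minimal spanning tree in slabs*,
  Comm. Pure Appl. Math. 70 (2017) 2084–2120, arXiv:1512.09107: proof of Theorem 3.10, the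
  paragraph after (3.72) (p. 13) [NewmanTassionWu2017].
-/

noncomputable section

namespace Literature.Probability.Percolation

open MeasureTheory LatticeModels
open scoped LatticeModels

namespace NTW17

variable {k : ℕ}

/-! ## One block across the strip -/

/-- **A long-way crossing of a horizontal strip crosses every block placed across it.**  For a
lattice configuration: if the strip `[c₀, c₁] × [r, r']` is crossed from `x = c₀` to `x = c₁` and
`c₀ < a`, `a + w < c₁`, then the block `[a, a+w] × [r, r']` is crossed from `x = a` to `x = a + w`.
[cite: NewmanTassionWu2017, Theorem 3.10 (proof, "must cross λ disjoint 2n by n-1 rectangles in the long direction")] -/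
theorem slabConn_block_of_hcross {ω : BondConfig (slab 3 k)} (hω : ω ⊆ (slabGraph 3 k).edgeSet)
    {c₀ c₁ r r' a w : ℤ} (ha : c₀ < a) (hw : 0 ≤ w) (haw : a + w < c₁)
    (h : ω ∈ slabConn k (boxR c₀ c₁ r r') {z | z.1 = c₀} {z | z.1 = c₁}) :
    ω ∈ slabConn k (boxR a (a + w) r r') {z | z.1 = a} {z | z.1 = a + w} := by
  obtain ⟨l, hl⟩ := (mem_slabConn_iff_exists_isOSAP ω _ _ _).1 h
  have eh := hl.head_mem hl.ne_nil; have el := hl.last_mem hl.ne_nil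
  simp only [mem_slabLift_iff, Set.mem_setOf_eq] at eh el
  have hφ : ∀ z w : ℤ × ℤ, planarAdj z w → (fun z : ℤ × ℤ => z.1) w ≤ (fun z : ℤ × ℤ => z.1) z + 1 :=
    fun z w h => (abs_sub_le_one_of_planarAdj h).1
  obtain ⟨v, -, hvX, hvc, e, he, hve⟩ := exists_crossVertex hω hφ (X := boxR a (a + w) r r') (c := a)
    (d := a + w) (by omega) hl.ne_nil hl.chain (fun z hz h1 h2 => by
      have := hl.subset z hz
      simp only [mem_slabLift_iff, mem_boxR_iff] at this ⊢; omega) (by omega) (by omega)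
  exact ⟨v, by simpa using hvc, e, by simpa using he, hve⟩

/-! ## The probability of a block crossing -/

/-- Translates of horizontal lines. [cite: NewmanTassionWu2017, §3.3 ("invariance under translation")] -/
theorem image_planarShift_row (v : ℤ × ℤ) (a : ℤ) :
    planarShift v '' {z : ℤ × ℤ | z.2 = a} = {z | z.2 = a + v.2} := by
  ext z
  simp only [Set.mem_image, planarShift_apply, Set.mem_setOf_eq]
  constructor
  · rintro ⟨w, hw, rfl⟩
    simp [hw]
  · intro hz
    exact ⟨z - v, by simp; omega, by simp⟩

/-- **A horizontal block crossing has probability `f_p(2n, n-1)`** (translation invariance): for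
`n ≥ 1`, the block `[a, a+2n] × [r, r+n-1]` is crossed from `x = a` to `x = a+2n` with probability
`crossingProb k p (2n) (n-1)`. [cite: NewmanTassionWu2017, Theorem 3.10 (proof, "each of these crossings occur with probability" f(2n,n-1))] -/
theorem real_hblock_eq_crossingProb (p : unitInterval) {n : ℕ} (hn : 1 ≤ n) (a r : ℤ) :
    (bondPercolation (slabGraph 3 k) p).real
        (slabConn k (boxR a (a + 2 * n) r (r + n - 1)) {z | z.1 = a} {z | z.1 = a + 2 * n}) =
      crossingProb k p (2 * n) (n - 1) := by
  have e1 : ((n - 1 : ℕ) : ℤ) = (n : ℤ) - 1 := by omega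
  have e0 : ((2 * n : ℕ) : ℤ) = 2 * (n : ℤ) := by push_cast; ring
  rw [crossingProb_eq, e0, e1]
  have h := real_slabConn_image (k := k) (planarShift (a, r)) (planarAdj_planarShift (a, r)) p
    (boxR 0 (2 * (n : ℤ)) 0 ((n : ℤ) - 1)) {z | z.1 = 0} {z | z.1 = 2 * (n : ℤ)}
  rw [image_planarShift_boxR, image_planarShift_col, image_planarShift_col] at h
  have e2 : (2 * (n : ℤ) + (a, r).1) = a + 2 * n := by simp only; ring
  have e3 : ((n : ℤ) - 1 + (a, r).2) = r + n - 1 := by simp only; ring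
  have e4 : (0 + (a, r).1) = a := by simp
  have e5 : (0 + (a, r).2) = r := by simp
  rw [e2, e3, e4, e5] at h
  exact h

/-- **A vertical block crossing has probability `f_p(2n, n-1)`** (diagonal symmetry and
translation): for `n ≥ 1`, the block `[r, r+n-1] × [a, a+2n]` is crossed from `y = a` to `y = a+2n`
with probability `crossingProb k p (2n) (n-1)`. [cite: NewmanTassionWu2017, Theorem 3.10 (proof, "each of these crossings occur with probability" f(2n,n-1))] -/
theorem real_vblock_eq_crossingProb (p : unitInterval) {n : ℕ} (hn : 1 ≤ n) (a r : ℤ) :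
    (bondPercolation (slabGraph 3 k) p).real
        (slabConn k (boxR r (r + n - 1) a (a + 2 * n)) {z | z.2 = a} {z | z.2 = a + 2 * n}) =
      crossingProb k p (2 * n) (n - 1) := by
  rw [← real_hblock_eq_crossingProb (k := k) p hn a r]
  have h := real_slabConn_image (k := k) planarSwap planarAdj_planarSwap p
    (boxR a (a + 2 * n) r (r + n - 1)) {z | z.1 = a} {z | z.1 = a + 2 * n}
  rw [image_planarSwap_boxR, image_planarSwap_eq, image_planarSwap_eq] at h
  rw [← h]
  congr 2

/-! ## Independence of the blocks -/

/-- Rectangles are finite. [folklore] -/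
private theorem boxR_fin' (a b c d : ℤ) : (boxR a b c d).Finite := by
  refine ((Set.finite_Icc a b).prod (Set.finite_Icc c d)).subset fun z hz => ?_
  simp only [mem_boxR_iff] at hz
  exact ⟨⟨hz.1, hz.2.1⟩, ⟨hz.2.2.1, hz.2.2.2⟩⟩

/-- **`P[horizontal strip crossed the long way] ≤ f_p(2n,n-1)^m`**: a horizontal strip of the `n` rows
`[r, r+n-1]` crossed from `x = c₀` to `x = c₁` with `c₀ + 1 + m(2n+1) ≤ c₁` contains crossings of the
`m` disjoint blocks `[c₀+1+j(2n+1), c₀+1+j(2n+1)+2n] × [r, r+n-1]`, which are independent and each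
has probability `f_p(2n, n-1)`. [cite: NewmanTassionWu2017, Theorem 3.10 (proof, the paragraph after (3.72))] -/
theorem real_hcross_le_pow (p : unitInterval) {n : ℕ} (hn : 1 ≤ n) {c₀ c₁ r : ℤ} {m : ℕ}
    (hm : c₀ + 1 + (m : ℤ) * (2 * n + 1) ≤ c₁) :
    (bondPercolation (slabGraph 3 k) p).real
        (slabConn k (boxR c₀ c₁ r (r + n - 1)) {z | z.1 = c₀} {z | z.1 = c₁}) ≤
      crossingProb k p (2 * n) (n - 1) ^ m := by
  set P := bondPercolation (slabGraph 3 k) p with hP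
  -- the blocks
  set x : ℕ → ℤ := fun j => c₀ + 1 + (j : ℤ) * (2 * n + 1) with hx
  set E : ℕ → Set (BondConfig (slab 3 k)) := fun j =>
    slabConn k (boxR (x j) (x j + 2 * n) r (r + n - 1)) {z | z.1 = x j} {z | z.1 = x j + 2 * n} with hE
  set T : ℕ → Set (Sym2 (slab 3 k)) := fun j => Set.sym2 (slabLift k (boxR (x j) (x j + 2 * n) r (r + n - 1))) with hT
  -- the crossing lies in every block crossing, almost surely
  have hae : ∀ᵐ ω ∂P, ω ∈ slabConn k (boxR c₀ c₁ r (r + n - 1)) {z | z.1 = c₀} {z | z.1 = c₁} →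
      ω ∈ ⋂ j ∈ Finset.range m, E j := by
    filter_upwards [ae_subset_edgeSet (slabGraph 3 k) p] with ω hω h
    simp only [Set.mem_iInter, Finset.mem_range]
    intro j hj
    have hj' : (j : ℤ) + 1 ≤ m := by exact_mod_cast hj
    refine slabConn_block_of_hcross hω ?_ (by positivity) ?_ h
    · simp only [hx]; nlinarith
    · simp only [hx]; nlinarith
  have h1 : P.real (slabConn k (boxR c₀ c₁ r (r + n - 1)) {z | z.1 = c₀} {z | z.1 = c₁}) ≤
      P.real (⋂ j ∈ Finset.range m, E j) := by
    simp only [measureReal_def]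
    exact ENNReal.toReal_mono (measure_ne_top _ _) (measure_mono_ae hae)
  -- independence
  have hdet : ∀ j, DeterminedBy (E j) (T j) := fun j => determinedBy_slabConn k _ _ subset_rfl
  have hmeas : ∀ j, MeasurableSet (E j) := fun j => measurableSet_slabConn_of_finite k (boxR_fin' _ _ _ _) _ _
  have hdisj : ∀ i j, i ≠ j → Disjoint (T i) (T j) := by
    intro i j hij
    refine disjoint_sym2_slabLift (Set.disjoint_left.2 fun z hz hz' => ?_)
    simp only [mem_boxR_iff, hx] at hz hz'
    rcases lt_or_gt_of_ne hij with h | h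
    · have : (i : ℤ) + 1 ≤ j := by exact_mod_cast h
      nlinarith
    · have : (j : ℤ) + 1 ≤ i := by exact_mod_cast h
      nlinarith
  have h2 := real_biInter_eq_prod (slabGraph 3 k) p E T hdet hmeas hdisj m
  have h3 : ∀ j, P.real (E j) = crossingProb k p (2 * n) (n - 1) := fun j =>
    real_hblock_eq_crossingProb p hn (x j) r
  rw [h2, Finset.prod_eq_pow_card (fun i _ => h3 i), Finset.card_range] at h1
  exact h1

/-- **`P[vertical strip crossed the long way] ≤ f_p(2n,n-1)^m`** (the diagonal image of
`real_hcross_le_pow`). [cite: NewmanTassionWu2017, Theorem 3.10 (proof, the paragraph after (3.72))] -/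
theorem real_vcross_le_pow (p : unitInterval) {n : ℕ} (hn : 1 ≤ n) {c₀ c₁ r : ℤ} {m : ℕ}
    (hm : c₀ + 1 + (m : ℤ) * (2 * n + 1) ≤ c₁) :
    (bondPercolation (slabGraph 3 k) p).real
        (slabConn k (boxR r (r + n - 1) c₀ c₁) {z | z.2 = c₀} {z | z.2 = c₁}) ≤
      crossingProb k p (2 * n) (n - 1) ^ m := by
  have h := real_slabConn_image (k := k) planarSwap planarAdj_planarSwap p
    (boxR c₀ c₁ r (r + n - 1)) {z | z.1 = c₀} {z | z.1 = c₁}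
  rw [image_planarSwap_boxR, image_planarSwap_eq, image_planarSwap_eq] at h
  have e : (bondPercolation (slabGraph 3 k) p).real
      (slabConn k (boxR r (r + n - 1) c₀ c₁) {z | z.2 = c₀} {z | z.2 = c₁}) =
      (bondPercolation (slabGraph 3 k) p).real
        (slabConn k (boxR c₀ c₁ r (r + n - 1)) {z | z.1 = c₀} {z | z.1 = c₁}) := by
    rw [← h]; congr 2
  rw [e]
  exact real_hcross_le_pow p hn hm

/-! ## The four hub strips -/

section Hub

variable {N n : ℕ}

/-- **Smallness of the hub crossings**: for `n ≥ 1` and `m(2n+1) ≤ 2N - 3`, each of the four hub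
strips is crossed the long way with probability at most `f_p(2n, n-1)^m`.
[cite: NewmanTassionWu2017, Theorem 3.10 (proof, "P[L(S₂) ⟷^{S₂} T(S₂)] ≤ 2^{-λ}")] -/
theorem real_hubCross_le_pow (p : unitInterval) (hn : 1 ≤ n) {m : ℕ}
    (hm : (m : ℤ) * (2 * n + 1) ≤ 2 * (N : ℤ) - 3) :
    (bondPercolation (slabGraph 3 k) p).real (hubCrossT k N n) ≤ crossingProb k p (2 * n) (n - 1) ^ m ∧
      (bondPercolation (slabGraph 3 k) p).real (hubCrossR k N n) ≤ crossingProb k p (2 * n) (n - 1) ^ m ∧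
      (bondPercolation (slabGraph 3 k) p).real (hubCrossB k N n) ≤ crossingProb k p (2 * n) (n - 1) ^ m ∧
      (bondPercolation (slabGraph 3 k) p).real (hubCrossL k N n) ≤ crossingProb k p (2 * n) (n - 1) ^ m := by
  have hm' : (-(N : ℤ) + 1) + 1 + (m : ℤ) * (2 * n + 1) ≤ (N : ℤ) - 1 := by omega
  refine ⟨?_, ?_, ?_, ?_⟩
  · have h := real_hcross_le_pow (k := k) p hn (r := (N : ℤ) + 1) hm'
    have e : ((N : ℤ) + 1) + n - 1 = (N : ℤ) + n := by ring
    rw [e] at h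
    exact h
  · have h := real_vcross_le_pow (k := k) p hn (r := (N : ℤ) + 1) hm'
    have e : ((N : ℤ) + 1) + n - 1 = (N : ℤ) + n := by ring
    rw [e] at h
    exact h
  · have h := real_hcross_le_pow (k := k) p hn (r := -((N : ℤ) + n)) hm'
    have e : -((N : ℤ) + n) + n - 1 = -((N : ℤ) + 1) := by ring
    rw [e] at h
    exact h
  · have h := real_vcross_le_pow (k := k) p hn (r := -((N : ℤ) + n)) hm'
    have e : -((N : ℤ) + n) + n - 1 = -((N : ℤ) + 1) := by ring
    rw [e] at h
    exact h

end Hub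

end NTW17

end Literature.Probability.Percolation

end
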